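/-
Copyright (c) 2026 the pub-hodgecm-mathlib formalisation cell (harness21).  Prover seat hodgecm-mathlib-F0P3a-p01 (g36), req620 Track A «(D-RAM) FOUR-FRAME» squad — STAGE-1b
directive (D-1b) §3: FIRST HAND on `stub_law_levHi` ∕ `stub_law_levLo`, step (L2c) «THE COMPOSITION ENGINE» for the two-token LEVEL pieces (the (L-lev) twin of LH4-p12 (g7)'s ★
p859556 (S2c)).  Helper lane `--supports stmt-HodgeConjecture-24833`.  2026-09-04.
-/
import Summits.HodgeConjecture.HodgeConjecture.Theorems.F0P3cDyRamSqKappaSignModelSumOfLabelledStageB   -- ★ p859556 (LH4-p12 (g7)) (S2c); brings ★ p859535 `fencedLevelsKappaSignSlot_of_labelledModelSum`, ★ `StableModelSumOfStageB` helpers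
import Summits.HodgeConjecture.HodgeConjecture.Theorems.F0P3cDyRamDiagonalKappaOrbitCountLabelled      -- ★ p858900 (LH4-p09 (g8)) (L-model-K): `cast_sum_signChar_mul_ncard_levels_eq_eight_mul_finsum_kappaCount` = (L2a-κ) ALREADY ★
import Summits.HodgeConjecture.HodgeConjecture.Theorems.F0P3cDyRamStageOneBDefs                        -- ★ p859562 DEFS LEAF №5 (this seat): `LevKappaSignLawAtS2`, `la∕cs∕kl∕blOfRecord`, `amplCs`, `amplLevHi`
import HarnessLib

/-!
# Crux `H413`, line LH4 «(D-RAM) FOUR-FRAME» road, STAGE 1b — (L2c) THE COMPOSITION ENGINE FOR `stub_law_levHi` ∕ `stub_law_levLo`: the LABELLED signed κ-Stage B₀ with the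
# TWO-TOKEN label `D₁·M ⊆ ϖ^{la d}·M ∧ D₂·M ⊆ ϖ^{lb d}·M` ⟹ (★ p858900 labelled κ-Stage A, ★ p859535) the fenced two-level κ-law slots — BY NAME, the tier-0 ED. 5 stub statements

Cell `hodgecm-mathlib` (D-0151), FLOOR 0, crux item H413 = `stmt-HodgeConjecture-24833`, route of record `HCCMUnconditional`; squad F0∕P3c∕LH4 (req618∕req620) ∕ F0∕P3a.
THEOREMS ONLY (no `def`, no instance, no notation, no `sorry`, default heartbeats); lane `--supports stmt-HodgeConjecture-24833 --as helper` (count-neutral).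

WHAT IS PROVED — the LABELLED, TYPE-0-ONLY twin of the unit's (KSS²) engine ★ `kappaSignModelSum_of_kappaStageB_token`, with the TWO level tokens of the congruence-profile piece
`𝟙_{K_{la, lb}}` riding in every set-builder (`D₁ = diag(a²−1, b²−1, 0)`, `D₂ = D₁²`), exactly as LH4-p12 (g7)'s ★ p859556 does for the square-level piece — with ONE difference: the
labelled κ-Stage A₀ is NOT a binder here, it is LH4-p09 (g8)'s ★ p858900 `cast_sum_signChar_mul_ncard_levels_eq_eight_mul_finsum_kappaCount` (the levels instance of the labelled
κ-Stage A for ANY `diag(z)`-invariant label), so the engine takes ONE binder: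
* (L2b-κS) «LABELLED SIGNED κ-STAGE B₀, TWO TOKENS» — at every wild datum behind the fence, square element datum `(a², b²; n)` at `depthOfRecord d`, `T = diag(a², b², 1)`,
  `2k + d = Σn + 2`, slot `i`, `2B = n_i − d + 2 − 2·shiftR d t`:
  `Σᶠ_{M ∈ 𝓛₀(T), D₁M ⊆ ϖ^{la d}M ∧ D₂M ⊆ ϖ^{lb d}M} κ₀,ᵢ(M)·w(M) = (Ω_i·w_i·baseSign_i·ω(fPartProd δ (a,b,1) i))·A(q, d, t, k, B)∕4` (the labelled twin of ★ p857128 `kappaSignCount2_typeZero`;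
  the set is ★ p858900's — no dualisability conjunct: `κ₀,ᵢ(M) = 0` off the dualisable lattices, ★ `kappaCount_zero_eq_zero_of_not_isDualisableLattice`, so §1 gives the bridge to the
  dualisable form the unit's ★ Stage-B tables are stated in, and both forms of the binder are served).
* §2 **`levKappaSignModelSum2_of_labelledKappaStageB (Ω la lb A) (hBκS0lev)`** ⟹ (lev-KSS²), the `hLKSS` binder of ★ p859535 `fencedLevelsKappaSignSlot_of_labelledModelSum shiftR Ω
  depthOfRecord la lb A`, for every `K`; **`fencedLevKappaSignSlot_of_labelledKappaStageB`** ∘ ★ p859535 ⟹ the FENCED TWO-LEVEL LAW SLOT (`hLlo`∕`hLhi` of ★ p859234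
  `pieceRowsWild_gselStar_two_of_fencedLaws_of_hsides`) at `(shiftR, Ω, depthOfRecord, la, lb, A)`; the `…_dualisable` variants take (L2b-κS) on the dualisable set.
* §3 BY NAME (★ DEFS LEAF №5): **`dyadicFence_levKappaSignLawAtS2_of_labelledKappaStageB (Ω la lb kl bl) (hB)` : `DyadicFence (LevKappaSignLawAtS2 shiftR Ω depthOfRecord la lb kl bl σ ϖ d t)`**
  (amplitude letter `A := fun q d _t k B => ampl q (k − kl d) (B − bl d)`, δ-equal to the Prop's RHS), and the two instances of record
  **`dyadicFence_levKappaSignLawAtS2_high_ofRecord_of_labelledKappaStageB`** (`laHighOfRecord, mstarOfRecord, klOfRecord, blOfRecord`; `A = amplLevHi`) = tier-0 ED. 5 `stub_law_levHi`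
  MODULO EXACTLY (L2b-κS)-hi, and **`…_low_ofRecord_…`** (`laLowOfRecord, mstarOfRecord, csOfRecord, csOfRecord`; `A = amplCs`) = `stub_law_levLo` MODULO EXACTLY (L2b-κS)-lo — whose END
  statements are thereby FIXED for the hands the dealer names (D-1b §3; organs: LH4-p09 (g8) labelled strata ★ p859094 ∕ p859257 ∕ p859313 ∕ p859518 ∕ `LabelledGluedLocusCensus*`,
  ★ `LevelTokenHNF`; κ weights ★ `KappaCountTypeZeroSigned` TRUNK pattern).
NOTHING IS CLAIMED ABOUT (L2b-κS): it is a BINDER (a census law — a PROVER TARGET; fit of record (r6) SIGSHEET-1b F3 33∕33 + q = 4 at the upper instance, F1+F2 40∕40 at the lower).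
HONEST LABEL.  Count-neutral helper: states no law, pays no stub; tier-0 rows T₊∕T₋∕regular OPEN; `HC_CM` is proved only modulo the 7 printed citations (2 remaining named inputs:
hLiu418 = `stmt-HodgeConjecture-24832`, h413 = `stmt-HodgeConjecture-24833`) until rung 0 closes.

## References
* [Kottwitz1986BaseChangeUnits] R. E. Kottwitz, *Base change for unit elements of Hecke algebras*, Compositio Math. 60 (1986), §1 pp. 240–241.
* [Rogawski1990] J. D. Rogawski, *Automorphic Representations of Unitary Groups in Three Variables*, Ann. of Math. Stud. 123 (1990), §4.9 Prop. 4.9.1 (a)(b) p. 55, §4.10 p. 58.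
* [LanglandsShelstad1987] R. P. Langlands, D. Shelstad, *On the definition of transfer factors*, Math. Ann. 278 (1987), §1.3, §3.
-/

set_option autoImplicit false

noncomputable section

namespace Summit.HodgeConjecture.HodgeConjecture.Cruxes.H413.F0P3cDyRamLevKappaSignModelSumOfLabelledStageB

open scoped Valued WithZero Matrix MatrixGroups
open Literature.NumberTheory.Automorphic Literature.NumberTheory.Automorphic.HermitianLattice
open Literature.NumberTheory.Automorphic.UnitaryLatticeTree Literature.NumberTheory.Automorphic.UnitaryThreeFourFrame
open Summit.HodgeConjecture.HodgeConjecture.Cruxes.H413.F0P3cDyRamFourFrameLawDefs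
open Summit.HodgeConjecture.HodgeConjecture.Cruxes.H413.F0P3cDyRamFourFrameLawDefsR
open Summit.HodgeConjecture.HodgeConjecture.Cruxes.H413.F0P3cDyRamFourFrameLawDefsR2
open Summit.HodgeConjecture.HodgeConjecture.Cruxes.H413.F0P3cDyRamFourFrameCensusDefs
open Summit.HodgeConjecture.HodgeConjecture.Cruxes.H413.F0P3cDyRamFourFramePieces
open Summit.HodgeConjecture.HodgeConjecture.Cruxes.H413.F0P3cDyRamDiagonalTorusDefs
open Summit.HodgeConjecture.HodgeConjecture.Cruxes.H413.F0P3cDyRamDiagonalStrataDefs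
open Summit.HodgeConjecture.HodgeConjecture.Cruxes.H413.F0P3cDyRamDiagonalKappaCountDefs
open Summit.HodgeConjecture.HodgeConjecture.Cruxes.H413.F0P3cDyRamStableModelSumOfStageB
open Summit.HodgeConjecture.HodgeConjecture.Cruxes.H413.F0P3cDyRamLevelsKappaSignLawOfLabelledModelSum
open Summit.HodgeConjecture.HodgeConjecture.Cruxes.H413.F0P3cDyRamDiagonalKappaOrbitCountLabelled
open Summit.HodgeConjecture.HodgeConjecture.Cruxes.H413.F0P3cDyRamOmegaRDefs
open Summit.HodgeConjecture.HodgeConjecture.Cruxes.H413.F0P3cDyRamStageOneBDefs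

/-! ## §1  The dualisability bridge: `κ₀` vanishes off the dualisable lattices, so the labelled κ-sum may be taken over ★ p858900's set or over its dualisable part -/

section Bridge

variable {K : Type} [Field K] [Valued K ℤᵐ⁰]

/-- **THE LABELLED κ₀-SUM IGNORES NON-DUALISABLE LATTICES**: for ANY predicate `P` on lattices, `Σᶠ_{M ∈ 𝓛₀(T), P M} κ₀,ᵢ(M)·w(M) = Σᶠ_{M ∈ 𝓛₀(T), dualisable, P M} κ₀,ᵢ(M)·w(M)`
(★ `kappaCount_zero_eq_zero_of_not_isDualisableLattice`: no polarisation coset ⇒ `κ₀,ᵢ = 0`; the two `Set.indicator`s agree pointwise).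
[cite: Kottwitz1986BaseChangeUnits, §1 pp. 240–241] -/
theorem finsum_mem_labelled_eq_finsum_mem_dualisable (σ : K →+* K) (ϖ : K) (T : GL (Fin 3) K) (i : Fin 3) (P : Submodule 𝒪[K] (Fin 3 → K) → Prop) :
    ∑ᶠ M ∈ {M : Submodule 𝒪[K] (Fin 3 → K) | M ∈ normalisedStableLattices T ∧ P M}, (kappaCount σ ϖ 0 i M : ℚ) * stabiliserWeight σ M =
      ∑ᶠ M ∈ {M : Submodule 𝒪[K] (Fin 3 → K) | M ∈ normalisedStableLattices T ∧ IsDualisableLattice σ ϖ M ∧ P M},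
        (kappaCount σ ϖ 0 i M : ℚ) * stabiliserWeight σ M := by
  classical
  rw [finsum_mem_def, finsum_mem_def]
  refine finsum_congr fun M => ?_
  by_cases hdual : IsDualisableLattice σ ϖ M
  · by_cases hM : M ∈ normalisedStableLattices T ∧ P M
    · rw [Set.indicator_of_mem (show M ∈ {M | M ∈ normalisedStableLattices T ∧ P M} from hM),
        Set.indicator_of_mem (show M ∈ {M | M ∈ normalisedStableLattices T ∧ IsDualisableLattice σ ϖ M ∧ P M} from ⟨hM.1, hdual, hM.2⟩)]
    · rw [Set.indicator_of_notMem (show M ∉ {M | M ∈ normalisedStableLattices T ∧ P M} from hM),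
        Set.indicator_of_notMem (show M ∉ {M | M ∈ normalisedStableLattices T ∧ IsDualisableLattice σ ϖ M ∧ P M} from fun h => hM ⟨h.1, h.2.2⟩)]
  · have h0 : (kappaCount σ ϖ 0 i M : ℚ) * stabiliserWeight σ M = 0 := by
      rw [kappaCount_zero_eq_zero_of_not_isDualisableLattice σ ϖ i M hdual, Int.cast_zero, zero_mul]
    by_cases hM : M ∈ normalisedStableLattices T ∧ P M
    · rw [Set.indicator_of_mem (show M ∈ {M | M ∈ normalisedStableLattices T ∧ P M} from hM),
        Set.indicator_of_notMem (show M ∉ {M | M ∈ normalisedStableLattices T ∧ IsDualisableLattice σ ϖ M ∧ P M} from fun h => hdual h.2.1), h0]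
    · rw [Set.indicator_of_notMem (show M ∉ {M | M ∈ normalisedStableLattices T ∧ P M} from hM),
        Set.indicator_of_notMem (show M ∉ {M | M ∈ normalisedStableLattices T ∧ IsDualisableLattice σ ϖ M ∧ P M} from fun h => hM ⟨h.1, h.2.2⟩)]

end Bridge

/-! ## §2  (L2c) the composition engine: (L2b-κS) ⟹ (lev-KSS²) ⟹ the fenced two-level κ-law slot, for every `K` -/

/-- **(L2c) THE COMPOSITION ENGINE** — ★ p858900 labelled κ-Stage A (levels instance) + the labelled signed κ-Stage B₀ with two tokens (L2b-κS) ⟹ the Ω-aware eightfold LABELLED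
κ-model sum (lev-KSS²) for every `K`, in the exact shape of ★ p859535 `fencedLevelsKappaSignSlot_of_labelledModelSum`'s binder `hLKSS` at `(shiftR, Ω, depthOfRecord, la, lb, A)`.  Proof =
★ p859556's, the labelled Stage A discharged by name: `c` is a non-norm (★ `not_exists_mul_map_eq_of_dichotomy`), `(a², b², 1)` is a regular unit diagonal (★ `v_vecCons_eq_one_of_isElementDatum`,
★ `vecCons_injective_of_isElementDatum`), then `8·(S·A∕4) = 2·S·A`. [cite: Kottwitz1986BaseChangeUnits, §1 pp. 240–241] [cite: Rogawski1990, §4.9 Prop. 4.9.1 (a) p. 55] [cite: LanglandsShelstad1987, §1.3] -/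
theorem levKappaSignModelSum2_of_labelledKappaStageB (Ω : OmegaSchedule) (la lb : ℕ → ℕ) (A : ℕ → ℕ → ℕ → ℕ → ℤ → ℚ)
    (hBκS0lev : ∀ {K : Type} [Field K] [Valued K ℤᵐ⁰] [CompleteSpace K] [Fintype 𝓀[K]] {σ : K →+* K} {ϖ : K} {d t : ℕ}, IsRamifiedQuadraticDatum σ ϖ d t →
      Valued.v (2 : K) < 1 → ∀ {δ : K}, σ δ = -δ → δ ≠ 0 →
      ∀ {a b : K}, a * σ a = 1 → b * σ b = 1 → Valued.v (a - 1) < Valued.v (2 : K) → Valued.v (b - 1) < Valued.v (2 : K) →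
      ∀ {n₁ n₂ n₃ : ℕ}, IsElementDatum σ ϖ (depthOfRecord d) (a * a) (b * b) n₁ n₂ n₃ →
      ∀ (T : GL (Fin 3) K), (T : Matrix (Fin 3) (Fin 3) K) = Matrix.diagonal ![a * a, b * b, 1] → ∀ (k : ℕ), 2 * k + d = n₁ + n₂ + n₃ + 2 →
      ∀ (i : Fin 3) (B : ℤ), 2 * B = ((![n₁, n₂, n₃] : Fin 3 → ℕ) i : ℤ) - d + 2 - 2 * shiftR d t →
        ∑ᶠ M ∈ {M : Submodule 𝒪[K] (Fin 3 → K) | M ∈ normalisedStableLattices T ∧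
            (LatticeInLevel ϖ (la d) (Matrix.diagonal ![a * a - 1, b * b - 1, 0]) M ∧
              LatticeInLevel ϖ (lb d) (Matrix.diagonal ![(a * a - 1) * (a * a - 1), (b * b - 1) * (b * b - 1), 0]) M)},
            (kappaCount σ ϖ 0 i M : ℚ) * stabiliserWeight σ M =
          ((Ω K σ ϖ d a b i * ((![normSign σ (-1 : K), normSign σ (-1 : K), 1] : Fin 3 → ℤ) i *
            (baseSign σ i * normSign σ (fPartProd δ ![a, b, 1] i))) : ℤ) : ℚ) * A (Fintype.card 𝓀[K]) d t k B / 4)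
    {K : Type} [Field K] [Valued K ℤᵐ⁰] [CompleteSpace K] [Fintype 𝓀[K]] (σ : K →+* K) (ϖ : K) (d t : ℕ) :
    Valued.v (2 : K) < 1 → IsRamifiedQuadraticDatum σ ϖ d t →
      ∀ c : K, σ c = c → Valued.v c = 1 → (∀ x : K, σ x = x → x ≠ 0 → (∃ z : K, z * σ z = x) ∨ ∃ z : K, z * σ z = c * x) →
      ∀ (δ : K), σ δ = -δ → δ ≠ 0 →
      ∀ (a b : K), a * σ a = 1 → b * σ b = 1 → Valued.v (a - 1) < Valued.v (2 : K) → Valued.v (b - 1) < Valued.v (2 : K) →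
      ∀ (n₁ n₂ n₃ : ℕ), IsElementDatum σ ϖ (depthOfRecord d) (a * a) (b * b) n₁ n₂ n₃ →
      ∀ (T : GL (Fin 3) K), (T : Matrix (Fin 3) (Fin 3) K) = Matrix.diagonal ![a * a, b * b, 1] →
      ∀ (k : ℕ), 2 * k + d = n₁ + n₂ + n₃ + 2 →
      ∀ (i : Fin 3) (B : ℤ), 2 * B = ((![n₁, n₂, n₃] : Fin 3 → ℕ) i : ℤ) - d + 2 - 2 * shiftR d t →
        ((∑ s : Fin 3 → Bool,
            (![(if s 1 then -1 else 1) * (if s 2 then -1 else 1),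
               (if s 0 then -1 else 1) * (if s 2 then -1 else 1),
               (if s 0 then -1 else 1) * (if s 1 then -1 else 1)] : Fin 3 → ℤ) i *
              ({M : Submodule 𝒪[K] (Fin 3 → K) |
                IsVertexLattice σ ϖ (Matrix.diagonal fun j => if s j then c else (1 : K)) 0 M ∧ mapGL T M = M ∧
                  (LatticeInLevel ϖ (la d) (Matrix.diagonal ![a * a - 1, b * b - 1, 0]) M ∧
                    LatticeInLevel ϖ (lb d) (Matrix.diagonal ![(a * a - 1) * (a * a - 1), (b * b - 1) * (b * b - 1), 0]) M)}.ncard : ℤ) : ℤ) : ℚ) =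
          2 * ((Ω K σ ϖ d a b i * ((![normSign σ (-1 : K), normSign σ (-1 : K), 1] : Fin 3 → ℤ) i *
            (baseSign σ i * normSign σ (fPartProd δ ![a, b, 1] i))) : ℤ) : ℚ) * A (Fintype.card 𝓀[K]) d t k B := by
  intro h2 hD c hσc hcv hdich δ hδ hδ0 a b ha hb ha2 hb2 n₁ n₂ n₃ hE T hT k hk i B hB
  have hσ : ∀ x, σ (σ x) = x := hD.1
  have hvσ : ∀ a, Valued.v (σ a) = Valued.v a := hD.2.1
  have hϖ : Valued.v ϖ = WithZero.exp (-1 : ℤ) := hD.2.2.1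
  have hc : ¬ ∃ z : K, z * σ z = c := not_exists_mul_map_eq_of_dichotomy hD h2 hcv hdich
  have hs := v_vecCons_eq_one_of_isElementDatum hvσ hE
  have hreg := vecCons_injective_of_isElementDatum hE
  have hϖ0 : ϖ ≠ 0 := (Valuation.ne_zero_iff _).1 (by rw [hϖ]; exact WithZero.exp_ne_zero)
  have h8 : ∀ (X S' A' : ℚ), X = S' * A' / 4 → 8 * X = 2 * S' * A' := fun X S' A' h => by rw [h]; ring
  rw [cast_sum_signChar_mul_ncard_levels_eq_eight_mul_finsum_kappaCount hσ hvσ hϖ (Units.mk0 ϖ hϖ0) rfl hσc hcv hc hdich hs hreg T hT 0 i (la d) (lb d) _ _]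
  exact h8 _ _ _ (hBκS0lev hD h2 hδ hδ0 ha hb ha2 hb2 hE T hT k hk i B hB)

/-- **(L2c) on the DUALISABLE set** — the same engine with (L2b-κS) stated over `{M ∈ 𝓛₀(T), dualisable, labels}` (the unit's ★ Stage-B currency), through §1's bridge.
[cite: Kottwitz1986BaseChangeUnits, §1 pp. 240–241] [cite: Rogawski1990, §4.9 Prop. 4.9.1 (a) p. 55] [cite: LanglandsShelstad1987, §1.3] -/
theorem levKappaSignModelSum2_of_labelledKappaStageB_dualisable (Ω : OmegaSchedule) (la lb : ℕ → ℕ) (A : ℕ → ℕ → ℕ → ℕ → ℤ → ℚ)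
    (hBκS0levD : ∀ {K : Type} [Field K] [Valued K ℤᵐ⁰] [CompleteSpace K] [Fintype 𝓀[K]] {σ : K →+* K} {ϖ : K} {d t : ℕ}, IsRamifiedQuadraticDatum σ ϖ d t →
      Valued.v (2 : K) < 1 → ∀ {δ : K}, σ δ = -δ → δ ≠ 0 →
      ∀ {a b : K}, a * σ a = 1 → b * σ b = 1 → Valued.v (a - 1) < Valued.v (2 : K) → Valued.v (b - 1) < Valued.v (2 : K) →
      ∀ {n₁ n₂ n₃ : ℕ}, IsElementDatum σ ϖ (depthOfRecord d) (a * a) (b * b) n₁ n₂ n₃ →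
      ∀ (T : GL (Fin 3) K), (T : Matrix (Fin 3) (Fin 3) K) = Matrix.diagonal ![a * a, b * b, 1] → ∀ (k : ℕ), 2 * k + d = n₁ + n₂ + n₃ + 2 →
      ∀ (i : Fin 3) (B : ℤ), 2 * B = ((![n₁, n₂, n₃] : Fin 3 → ℕ) i : ℤ) - d + 2 - 2 * shiftR d t →
        ∑ᶠ M ∈ {M : Submodule 𝒪[K] (Fin 3 → K) | M ∈ normalisedStableLattices T ∧ IsDualisableLattice σ ϖ M ∧
            (LatticeInLevel ϖ (la d) (Matrix.diagonal ![a * a - 1, b * b - 1, 0]) M ∧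
              LatticeInLevel ϖ (lb d) (Matrix.diagonal ![(a * a - 1) * (a * a - 1), (b * b - 1) * (b * b - 1), 0]) M)},
            (kappaCount σ ϖ 0 i M : ℚ) * stabiliserWeight σ M =
          ((Ω K σ ϖ d a b i * ((![normSign σ (-1 : K), normSign σ (-1 : K), 1] : Fin 3 → ℤ) i *
            (baseSign σ i * normSign σ (fPartProd δ ![a, b, 1] i))) : ℤ) : ℚ) * A (Fintype.card 𝓀[K]) d t k B / 4)
    {K : Type} [Field K] [Valued K ℤᵐ⁰] [CompleteSpace K] [Fintype 𝓀[K]] (σ : K →+* K) (ϖ : K) (d t : ℕ) :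
    Valued.v (2 : K) < 1 → IsRamifiedQuadraticDatum σ ϖ d t →
      ∀ c : K, σ c = c → Valued.v c = 1 → (∀ x : K, σ x = x → x ≠ 0 → (∃ z : K, z * σ z = x) ∨ ∃ z : K, z * σ z = c * x) →
      ∀ (δ : K), σ δ = -δ → δ ≠ 0 →
      ∀ (a b : K), a * σ a = 1 → b * σ b = 1 → Valued.v (a - 1) < Valued.v (2 : K) → Valued.v (b - 1) < Valued.v (2 : K) →
      ∀ (n₁ n₂ n₃ : ℕ), IsElementDatum σ ϖ (depthOfRecord d) (a * a) (b * b) n₁ n₂ n₃ →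
      ∀ (T : GL (Fin 3) K), (T : Matrix (Fin 3) (Fin 3) K) = Matrix.diagonal ![a * a, b * b, 1] →
      ∀ (k : ℕ), 2 * k + d = n₁ + n₂ + n₃ + 2 →
      ∀ (i : Fin 3) (B : ℤ), 2 * B = ((![n₁, n₂, n₃] : Fin 3 → ℕ) i : ℤ) - d + 2 - 2 * shiftR d t →
        ((∑ s : Fin 3 → Bool,
            (![(if s 1 then -1 else 1) * (if s 2 then -1 else 1),
               (if s 0 then -1 else 1) * (if s 2 then -1 else 1),
               (if s 0 then -1 else 1) * (if s 1 then -1 else 1)] : Fin 3 → ℤ) i *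
              ({M : Submodule 𝒪[K] (Fin 3 → K) |
                IsVertexLattice σ ϖ (Matrix.diagonal fun j => if s j then c else (1 : K)) 0 M ∧ mapGL T M = M ∧
                  (LatticeInLevel ϖ (la d) (Matrix.diagonal ![a * a - 1, b * b - 1, 0]) M ∧
                    LatticeInLevel ϖ (lb d) (Matrix.diagonal ![(a * a - 1) * (a * a - 1), (b * b - 1) * (b * b - 1), 0]) M)}.ncard : ℤ) : ℤ) : ℚ) =
          2 * ((Ω K σ ϖ d a b i * ((![normSign σ (-1 : K), normSign σ (-1 : K), 1] : Fin 3 → ℤ) i *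
            (baseSign σ i * normSign σ (fPartProd δ ![a, b, 1] i))) : ℤ) : ℚ) * A (Fintype.card 𝓀[K]) d t k B :=
  levKappaSignModelSum2_of_labelledKappaStageB Ω la lb A
    (fun hD h2 => fun hδ hδ0 => fun ha hb ha2 hb2 => fun hE T hT k hk i B hB => by
      rw [finsum_mem_labelled_eq_finsum_mem_dualisable]
      exact hBκS0levD hD h2 hδ hδ0 ha hb ha2 hb2 hE T hT k hk i B hB)
    σ ϖ d t

/-- **(L2b-κS) ⟹ THE FENCED TWO-LEVEL κ-LAW SLOT** (∘ ★ p859535 `fencedLevelsKappaSignSlot_of_labelledModelSum`): at `(shiftR, Ω, depthOfRecord, la, lb, A)`, for every `K`, the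
`hLlo`∕`hLhi` letter of ★ `…TierZeroRowsTwoThreeOfLevels.pieceRowsWild_gselStar_two_of_fencedLaws_of_hsides` (def-free slot text).  Nothing is claimed about (L2b-κS).
[cite: Rogawski1990, §4.9 Prop. 4.9.1 (a)(b) p. 55] [cite: LanglandsShelstad1987, §1.3] -/
theorem fencedLevKappaSignSlot_of_labelledKappaStageB (Ω : OmegaSchedule) (la lb : ℕ → ℕ) (A : ℕ → ℕ → ℕ → ℕ → ℤ → ℚ)
    (hBκS0lev : ∀ {K : Type} [Field K] [Valued K ℤᵐ⁰] [CompleteSpace K] [Fintype 𝓀[K]] {σ : K →+* K} {ϖ : K} {d t : ℕ}, IsRamifiedQuadraticDatum σ ϖ d t →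
      Valued.v (2 : K) < 1 → ∀ {δ : K}, σ δ = -δ → δ ≠ 0 →
      ∀ {a b : K}, a * σ a = 1 → b * σ b = 1 → Valued.v (a - 1) < Valued.v (2 : K) → Valued.v (b - 1) < Valued.v (2 : K) →
      ∀ {n₁ n₂ n₃ : ℕ}, IsElementDatum σ ϖ (depthOfRecord d) (a * a) (b * b) n₁ n₂ n₃ →
      ∀ (T : GL (Fin 3) K), (T : Matrix (Fin 3) (Fin 3) K) = Matrix.diagonal ![a * a, b * b, 1] → ∀ (k : ℕ), 2 * k + d = n₁ + n₂ + n₃ + 2 →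
      ∀ (i : Fin 3) (B : ℤ), 2 * B = ((![n₁, n₂, n₃] : Fin 3 → ℕ) i : ℤ) - d + 2 - 2 * shiftR d t →
        ∑ᶠ M ∈ {M : Submodule 𝒪[K] (Fin 3 → K) | M ∈ normalisedStableLattices T ∧
            (LatticeInLevel ϖ (la d) (Matrix.diagonal ![a * a - 1, b * b - 1, 0]) M ∧
              LatticeInLevel ϖ (lb d) (Matrix.diagonal ![(a * a - 1) * (a * a - 1), (b * b - 1) * (b * b - 1), 0]) M)},
            (kappaCount σ ϖ 0 i M : ℚ) * stabiliserWeight σ M =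
          ((Ω K σ ϖ d a b i * ((![normSign σ (-1 : K), normSign σ (-1 : K), 1] : Fin 3 → ℤ) i *
            (baseSign σ i * normSign σ (fPartProd δ ![a, b, 1] i))) : ℤ) : ℚ) * A (Fintype.card 𝓀[K]) d t k B / 4)
    {K : Type} [Field K] [Valued K ℤᵐ⁰] [CompleteSpace K] [Fintype 𝓀[K]] (σ : K →+* K) (ϖ : K) (d t : ℕ) :
    Valued.v (2 : K) < 1 → IsRamifiedQuadraticDatum σ ϖ d t →
      ∀ (f : Fin 4 → Fin 3 → (Fin 3 → K)), IsFourFrameFamily σ f →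
      ∀ (δ : K), σ δ = -δ → δ ≠ 0 →
      ∀ (a b : K), a * σ a = 1 → b * σ b = 1 → Valued.v (a - 1) < Valued.v (2 : K) → Valued.v (b - 1) < Valued.v (2 : K) →
      ∀ (n₁ n₂ n₃ : ℕ), IsElementDatum σ ϖ (depthOfRecord d) (a * a) (b * b) n₁ n₂ n₃ →
      ∀ (Γ : Fin 4 → GL (Fin 3) K), (∀ b', (Γ b' : Matrix (Fin 3) (Fin 3) K) = frameElt σ f b' (a * a) (b * b)) →
      ∀ (k : ℕ), 2 * k + d = n₁ + n₂ + n₃ + 2 →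
      ∀ (i : Fin 3) (B : ℤ), 2 * B = ((![n₁, n₂, n₃] : Fin 3 → ℕ) i : ℤ) - d + 2 - 2 * shiftR d t →
        ((∑ b' : Fin 4, kappaChar i b' * ({M : Submodule (Valued.integer K) (Fin 3 → K) | IsVertexLattice σ ϖ ((StdForm.antidiagonal 3).over K) 0 M ∧ mapGL (Γ b') M = M ∧
            (LatticeInLevel ϖ (la d) ((Γ b' : Matrix (Fin 3) (Fin 3) K) - 1) M ∧
              LatticeInLevel ϖ (lb d) (((Γ b' : Matrix (Fin 3) (Fin 3) K) - 1) * ((Γ b' : Matrix (Fin 3) (Fin 3) K) - 1)) M)}.ncard : ℤ) : ℤ) : ℚ) =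
          (Ω K σ ϖ d a b i * (baseSign σ i * normSign σ (fPartProd δ ![a, b, 1] i)) : ℤ) * A (Fintype.card 𝓀[K]) d t k B :=
  fencedLevelsKappaSignSlot_of_labelledModelSum shiftR Ω depthOfRecord la lb A
    (fun σ ϖ d t h2 hD c hσc hcv hdich δ hδ hδ0 a b ha hb ha2 hb2 n₁ n₂ n₃ hE T hT k hk i B hB =>
      levKappaSignModelSum2_of_labelledKappaStageB Ω la lb A hBκS0lev σ ϖ d t h2 hD c hσc hcv hdich δ hδ hδ0 a b ha hb ha2 hb2 n₁ n₂ n₃ hE T hT k hk i B hB)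
    σ ϖ d t

/-! ## §3  BY NAME: the tier-0 ED. 5 stub statements `stub_law_levHi` ∕ `stub_law_levLo` (★ DEFS LEAF №5 `LevKappaSignLawAtS2 …`) modulo exactly (L2b-κS)-hi ∕ (L2b-κS)-lo -/

/-- **(L2b-κS) ⟹ `DyadicFence (LevKappaSignLawAtS2 shiftR Ω depthOfRecord la lb kl bl σ ϖ d t)`** — the fenced two-level κ-law of ★ DEFS LEAF №5 BY NAME, for any schedules
`la lb kl bl`, with the binder's amplitude letter `A := fun q d _t k B => ampl q (k − kl d) (B − bl d)` (δ-equal to the Prop's right-hand side; `levFixCount` unfolds to the slot's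
set-builder).  [cite: Rogawski1990, §4.9 Prop. 4.9.1 (a)(b) p. 55] [cite: LanglandsShelstad1987, §1.3, §3] -/
theorem dyadicFence_levKappaSignLawAtS2_of_labelledKappaStageB (Ω : OmegaSchedule) (la lb kl bl : ℕ → ℕ)
    (hBκS0lev : ∀ {K : Type} [Field K] [Valued K ℤᵐ⁰] [CompleteSpace K] [Fintype 𝓀[K]] {σ : K →+* K} {ϖ : K} {d t : ℕ}, IsRamifiedQuadraticDatum σ ϖ d t →
      Valued.v (2 : K) < 1 → ∀ {δ : K}, σ δ = -δ → δ ≠ 0 →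
      ∀ {a b : K}, a * σ a = 1 → b * σ b = 1 → Valued.v (a - 1) < Valued.v (2 : K) → Valued.v (b - 1) < Valued.v (2 : K) →
      ∀ {n₁ n₂ n₃ : ℕ}, IsElementDatum σ ϖ (depthOfRecord d) (a * a) (b * b) n₁ n₂ n₃ →
      ∀ (T : GL (Fin 3) K), (T : Matrix (Fin 3) (Fin 3) K) = Matrix.diagonal ![a * a, b * b, 1] → ∀ (k : ℕ), 2 * k + d = n₁ + n₂ + n₃ + 2 →
      ∀ (i : Fin 3) (B : ℤ), 2 * B = ((![n₁, n₂, n₃] : Fin 3 → ℕ) i : ℤ) - d + 2 - 2 * shiftR d t →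
        ∑ᶠ M ∈ {M : Submodule 𝒪[K] (Fin 3 → K) | M ∈ normalisedStableLattices T ∧
            (LatticeInLevel ϖ (la d) (Matrix.diagonal ![a * a - 1, b * b - 1, 0]) M ∧
              LatticeInLevel ϖ (lb d) (Matrix.diagonal ![(a * a - 1) * (a * a - 1), (b * b - 1) * (b * b - 1), 0]) M)},
            (kappaCount σ ϖ 0 i M : ℚ) * stabiliserWeight σ M =
          ((Ω K σ ϖ d a b i * ((![normSign σ (-1 : K), normSign σ (-1 : K), 1] : Fin 3 → ℤ) i *
            (baseSign σ i * normSign σ (fPartProd δ ![a, b, 1] i))) : ℤ) : ℚ) * ampl (Fintype.card 𝓀[K]) (k - kl d) (B - bl d) / 4)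
    {K : Type} [Field K] [Valued K ℤᵐ⁰] [CompleteSpace K] [Fintype 𝓀[K]] (σ : K →+* K) (ϖ : K) (d t : ℕ) :
    DyadicFence (K := K) (LevKappaSignLawAtS2 shiftR Ω depthOfRecord la lb kl bl σ ϖ d t) :=
  fencedLevKappaSignSlot_of_labelledKappaStageB Ω la lb (fun q d _t k B => ampl q (k - kl d) (B - bl d)) hBκS0lev σ ϖ d t

/-- **`stub_law_levHi` MODULO (L2b-κS)-hi** — the UPPER shell-half law of record `DyadicFence (LevKappaSignLawAtS2 shiftR omegaR depthOfRecord laHighOfRecord mstarOfRecord klOfRecord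
blOfRecord σ ϖ d t)` (tier-0 ED. 5 `stub_law_levHi`'s statement, ★ DEFS LEAF №5 letters; amplitude `amplLevHi`) from the labelled signed κ-Stage B₀ at the two tokens
`(laHighOfRecord d, mstarOfRecord d) = (d % 2 + 1, m*)` with amplitude `amplLevHi`.  FIT OF RECORD of the binder: (r6) SIGSHEET-1b F3 33∕33 non-empty keys (d = 2, 3; q = 2) + q = 4; beyond
d ≤ 3 the `kl∕bl` schedule is the forced-Levi-law prediction.  [cite: Rogawski1990, §4.9 Prop. 4.9.1 (a)(b) p. 55] [cite: LanglandsShelstad1987, §1.3, §3] -/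
theorem dyadicFence_levKappaSignLawAtS2_high_ofRecord_of_labelledKappaStageB
    (hBκS0levHi : ∀ {K : Type} [Field K] [Valued K ℤᵐ⁰] [CompleteSpace K] [Fintype 𝓀[K]] {σ : K →+* K} {ϖ : K} {d t : ℕ}, IsRamifiedQuadraticDatum σ ϖ d t →
      Valued.v (2 : K) < 1 → ∀ {δ : K}, σ δ = -δ → δ ≠ 0 →
      ∀ {a b : K}, a * σ a = 1 → b * σ b = 1 → Valued.v (a - 1) < Valued.v (2 : K) → Valued.v (b - 1) < Valued.v (2 : K) →
      ∀ {n₁ n₂ n₃ : ℕ}, IsElementDatum σ ϖ (depthOfRecord d) (a * a) (b * b) n₁ n₂ n₃ →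
      ∀ (T : GL (Fin 3) K), (T : Matrix (Fin 3) (Fin 3) K) = Matrix.diagonal ![a * a, b * b, 1] → ∀ (k : ℕ), 2 * k + d = n₁ + n₂ + n₃ + 2 →
      ∀ (i : Fin 3) (B : ℤ), 2 * B = ((![n₁, n₂, n₃] : Fin 3 → ℕ) i : ℤ) - d + 2 - 2 * shiftR d t →
        ∑ᶠ M ∈ {M : Submodule 𝒪[K] (Fin 3 → K) | M ∈ normalisedStableLattices T ∧
            (LatticeInLevel ϖ (laHighOfRecord d) (Matrix.diagonal ![a * a - 1, b * b - 1, 0]) M ∧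
              LatticeInLevel ϖ (mstarOfRecord d) (Matrix.diagonal ![(a * a - 1) * (a * a - 1), (b * b - 1) * (b * b - 1), 0]) M)},
            (kappaCount σ ϖ 0 i M : ℚ) * stabiliserWeight σ M =
          ((omegaR K σ ϖ d a b i * ((![normSign σ (-1 : K), normSign σ (-1 : K), 1] : Fin 3 → ℤ) i *
            (baseSign σ i * normSign σ (fPartProd δ ![a, b, 1] i))) : ℤ) : ℚ) * amplLevHi (Fintype.card 𝓀[K]) d t k B / 4)
    {K : Type} [Field K] [Valued K ℤᵐ⁰] [CompleteSpace K] [Fintype 𝓀[K]] (σ : K →+* K) (ϖ : K) (d t : ℕ) :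
    DyadicFence (K := K) (LevKappaSignLawAtS2 shiftR omegaR depthOfRecord laHighOfRecord mstarOfRecord klOfRecord blOfRecord σ ϖ d t) :=
  dyadicFence_levKappaSignLawAtS2_of_labelledKappaStageB omegaR laHighOfRecord mstarOfRecord klOfRecord blOfRecord hBκS0levHi σ ϖ d t

/-- **`stub_law_levLo` MODULO (L2b-κS)-lo** — the LOWER shell-half law of record `DyadicFence (LevKappaSignLawAtS2 shiftR omegaR depthOfRecord laLowOfRecord mstarOfRecord csOfRecord
csOfRecord σ ϖ d t)` (tier-0 ED. 5 `stub_law_levLo`'s statement; amplitude `amplCs`) from the labelled signed κ-Stage B₀ at the two tokens `(laLowOfRecord d, mstarOfRecord d) = (d % 2, m*)`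
with amplitude `amplCs`.  FIT OF RECORD of the binder: (r6) SIGSHEET-1b F1 + F2, 40∕40 keys (d ≤ 3) + q = 4 (the lower half IS the square level by (L-lev-0) — so this binder also follows
from LH4-p12 (g7)'s (S2b-κS) + (T3) `LevLowEqSqAt`, a second road).  [cite: Rogawski1990, §4.9 Prop. 4.9.1 (a)(b) p. 55] [cite: LanglandsShelstad1987, §1.3, §3] -/
theorem dyadicFence_levKappaSignLawAtS2_low_ofRecord_of_labelledKappaStageB
    (hBκS0levLo : ∀ {K : Type} [Field K] [Valued K ℤᵐ⁰] [CompleteSpace K] [Fintype 𝓀[K]] {σ : K →+* K} {ϖ : K} {d t : ℕ}, IsRamifiedQuadraticDatum σ ϖ d t →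
      Valued.v (2 : K) < 1 → ∀ {δ : K}, σ δ = -δ → δ ≠ 0 →
      ∀ {a b : K}, a * σ a = 1 → b * σ b = 1 → Valued.v (a - 1) < Valued.v (2 : K) → Valued.v (b - 1) < Valued.v (2 : K) →
      ∀ {n₁ n₂ n₃ : ℕ}, IsElementDatum σ ϖ (depthOfRecord d) (a * a) (b * b) n₁ n₂ n₃ →
      ∀ (T : GL (Fin 3) K), (T : Matrix (Fin 3) (Fin 3) K) = Matrix.diagonal ![a * a, b * b, 1] → ∀ (k : ℕ), 2 * k + d = n₁ + n₂ + n₃ + 2 →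
      ∀ (i : Fin 3) (B : ℤ), 2 * B = ((![n₁, n₂, n₃] : Fin 3 → ℕ) i : ℤ) - d + 2 - 2 * shiftR d t →
        ∑ᶠ M ∈ {M : Submodule 𝒪[K] (Fin 3 → K) | M ∈ normalisedStableLattices T ∧
            (LatticeInLevel ϖ (laLowOfRecord d) (Matrix.diagonal ![a * a - 1, b * b - 1, 0]) M ∧
              LatticeInLevel ϖ (mstarOfRecord d) (Matrix.diagonal ![(a * a - 1) * (a * a - 1), (b * b - 1) * (b * b - 1), 0]) M)},
            (kappaCount σ ϖ 0 i M : ℚ) * stabiliserWeight σ M =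
          ((omegaR K σ ϖ d a b i * ((![normSign σ (-1 : K), normSign σ (-1 : K), 1] : Fin 3 → ℤ) i *
            (baseSign σ i * normSign σ (fPartProd δ ![a, b, 1] i))) : ℤ) : ℚ) * amplCs (Fintype.card 𝓀[K]) d t k B / 4)
    {K : Type} [Field K] [Valued K ℤᵐ⁰] [CompleteSpace K] [Fintype 𝓀[K]] (σ : K →+* K) (ϖ : K) (d t : ℕ) :
    DyadicFence (K := K) (LevKappaSignLawAtS2 shiftR omegaR depthOfRecord laLowOfRecord mstarOfRecord csOfRecord csOfRecord σ ϖ d t) :=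
  dyadicFence_levKappaSignLawAtS2_of_labelledKappaStageB omegaR laLowOfRecord mstarOfRecord csOfRecord csOfRecord hBκS0levLo σ ϖ d t

end Summit.HodgeConjecture.HodgeConjecture.Cruxes.H413.F0P3cDyRamLevKappaSignModelSumOfLabelledStageB

end
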